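import Summits.AnomalousDissipation.AnomalousDissipation.Theorems.MarginalStabilityChainStrainedLayerLawClockLine
import Summits.AnomalousDissipation.AnomalousDissipation.Theorems.MarginalStabilityChainStrainedLayerLawStubVorticityUniformBounds

/-!
# Stub `stub_negEnstrophyApriori` of line `FirstLemmasR2K4` (log-enstrophy clock; crux `MarginalStabilityChain.StrainedLayerLaw`,
# stmt-AnomalousDissipation-3007) — PROVED

Support file (`--supports stmt-AnomalousDissipation-3007`) proving the registered stub `stub_negEnstrophyApriori` of
the log-enstrophy clock line with its signature verbatim: for a classical solution `(u, v, p)` of the stretched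
two-dimensional Navier–Stokes layer system on `(0, ∞)` (`ν, L > 0`) with uniform exponential shear tails on compact
time intervals,

* (i) the negative enstrophy `Ω₋(t) = ∫_{x ∈ (0,L]} ∫_y ω₋²` (`ω₋ = max(−ω, 0)`, `ω = ∂ₓv − ∂_yu`) is bounded for
  `t ≥ 1`: pointwise `ω₋² ≤ ω²`, both slices are continuous and dominated by `C²e^{−k|y|}` on the period strip
  (shear tails at time `t`), so the two iterated integrals are strip integrals (Fubini) and monotonicity reduces the
  claim to the landed fixed-`ν` enstrophy bound `∫∫ω² ≤ B` (`stub_vorticityUniformBounds`, p120637);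
* (ii) `Ω₋(t) > 0` whenever the negative mass `M₋(t) = ∫∫ω₋ > 0` (`t > 0`): `Ω₋ ≥ 0`, and if `Ω₋ = 0` then the
  nonnegative strip-integrable `ω₋²` vanishes a.e. on the strip, hence so does `ω₋`, hence `M₋ = 0`.

All `[folklore]`. References: the line file `…ClockLine.lean` (objects `negMass`, `negEnstrophy`,
`negEnstrophy_nonneg`), tools `integral_iterated_eq_strip` (…StubStrainWorkIdentity), `tails_abs_vorticity_le`
(…StubMomentPairKernelStrip), `contDiff_one_vorticity` (…StubExcessEnergyKinematicB),
`integrableOn_strip_of_abs_le_exp` (Literature `StretchedLayerStripCalculus`).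
-/

-- `Summit.<Summit>.<Problem>` is the tree's mandated summit-side namespace (CONVENTIONS §2); for this
-- single-conjunct summit the two coincide, so the duplicate is deliberate.
set_option linter.dupNamespace false

noncomputable section

open scoped Topology ENNReal
open Filter Set Function MeasureTheory

namespace Summit.AnomalousDissipation.AnomalousDissipation.Theorems.StrainedLayerLaw.LogEnstrophyClock

open Literature.Analysis.FluidPDE Literature.Analysis.FluidPDE.StretchedLayer
open Summit.AnomalousDissipation.AnomalousDissipation.Theses.MarginalStabilityChain
open Summit.AnomalousDissipation.AnomalousDissipation.Theorems.StrainedLayerLaw.StrainWorkSumRule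

/-! ## Pointwise and strip-integrability facts for `ω₋` -/

/-- Pointwise `0 ≤ max(−a, 0) ≤ |a|`. [folklore] -/
private theorem negPart_le_abs (a : ℝ) : max (-a) 0 ≤ |a| :=
  max_le (neg_le_abs a) (abs_nonneg a)

/-- Pointwise `max(−a, 0)² ≤ a²`. [folklore] -/
private theorem negPart_sq_le_sq (a : ℝ) : (max (-a) 0) ^ 2 ≤ a ^ 2 := by
  rw [← sq_abs a]
  exact pow_le_pow_left₀ (le_max_right _ _) (negPart_le_abs a) 2

/-- **Strip facts at a positive time.** For a classical solution with uniform exponential shear tails on compact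
time intervals and `t > 0`: `ω₋(t)`, `ω₋(t)²` and `ω(t)²` are integrable on the period strip `(0, L] × ℝ`
(continuity of `ω(t)` — the slices are `C²` — and the tails bound `|ω(t)| ≤ Ce^{−k|y|}`). [folklore] -/
private theorem negPart_stripFacts {ν L : ℝ} {u v p : ℝ → ℝ → ℝ → ℝ}
    (hsol : IsStretchedLayerNSSolutionOn (Ioi 0) ν 1 1 L u v p)
    (htails : ∀ a b : ℝ, 0 < a → a < b → ExpTails (Icc a b) u v) {t : ℝ} (ht : 0 < t) :
    IntegrableOn (fun q : ℝ × ℝ => max (-(vorticity (u t) (v t) q.1 q.2)) 0) (Ioc 0 L ×ˢ univ) ∧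
    IntegrableOn (fun q : ℝ × ℝ => (max (-(vorticity (u t) (v t) q.1 q.2)) 0) ^ 2) (Ioc 0 L ×ˢ univ) ∧
    IntegrableOn (fun q : ℝ × ℝ => vorticity (u t) (v t) q.1 q.2 ^ 2) (Ioc 0 L ×ˢ univ) := by
  obtain ⟨C, k, hk, hCk⟩ := htails t (t + 1) ht (lt_add_one t)
  have hT : SliceTails C k (u t) (v t) := (hCk t ⟨le_rfl, (lt_add_one t).le⟩).1
  have hC : 0 ≤ C := hT.nonneg
  have hωb : ∀ x y, |vorticity (u t) (v t) x y| ≤ C * Real.exp (-k * |y|) := tails_abs_vorticity_le hT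
  have cω : Continuous fun q : ℝ × ℝ => vorticity (u t) (v t) q.1 q.2 :=
    (contDiff_one_vorticity (hsol.contDiff_u (mem_Ioi.2 ht)) (hsol.contDiff_v (mem_Ioi.2 ht))).continuous
  have cm : Continuous fun q : ℝ × ℝ => max (-(vorticity (u t) (v t) q.1 q.2)) 0 :=
    cω.neg.max continuous_const
  have hle1 : ∀ y : ℝ, Real.exp (-k * |y|) ≤ 1 := fun y =>
    Real.exp_le_one_iff.2 (by nlinarith [abs_nonneg y])
  -- `ω² ≤ C² e^{−k|y|}`
  have hsq : ∀ x y, vorticity (u t) (v t) x y ^ 2 ≤ C ^ 2 * Real.exp (-k * |y|) := by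
    intro x y
    have h1 := hωb x y
    have h2 : |vorticity (u t) (v t) x y| ≤ C := h1.trans (mul_le_of_le_one_right hC (hle1 y))
    calc vorticity (u t) (v t) x y ^ 2
        = |vorticity (u t) (v t) x y| * |vorticity (u t) (v t) x y| := by rw [← sq, sq_abs]
      _ ≤ C * (C * Real.exp (-k * |y|)) := mul_le_mul h2 h1 (abs_nonneg _) hC
      _ = C ^ 2 * Real.exp (-k * |y|) := by ring
  refine ⟨?_, ?_, ?_⟩
  · refine integrableOn_strip_of_abs_le_exp cm hC hk fun x _ y => ?_
    rw [abs_of_nonneg (le_max_right _ _)]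
    exact (negPart_le_abs _).trans (hωb x y)
  · refine integrableOn_strip_of_abs_le_exp (cm.pow 2) (by positivity : 0 ≤ C ^ 2) hk fun x _ y => ?_
    rw [abs_of_nonneg (sq_nonneg _)]
    exact (negPart_sq_le_sq _).trans (hsq x y)
  · refine integrableOn_strip_of_abs_le_exp (cω.pow 2) (by positivity : 0 ≤ C ^ 2) hk fun x _ y => ?_
    rw [abs_of_nonneg (sq_nonneg _)]
    exact hsq x y

/-! ## The stub -/

/-- **A-priori facts on the negative enstrophy (the registered stub `stub_negEnstrophyApriori`).** For every
classical solution of the stretched two-dimensional Navier–Stokes layer system on `(0, ∞)` (`ν, L > 0`) with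
uniform exponential shear tails on compact time intervals: (i) `Ω₋(t) ≤ B` for all `t ≥ 1` (from `ω₋² ≤ ω²`, Fubini
on the period strip and the fixed-`ν` enstrophy bound of `stub_vorticityUniformBounds`); (ii) for `t > 0`,
`M₋(t) > 0 ⇒ Ω₋(t) > 0` (if `Ω₋ = 0` the nonnegative integrable `ω₋²` vanishes a.e. on the strip, hence `ω₋` does,
hence `M₋ = 0`). [folklore] -/
theorem stub_negEnstrophyApriori : ∀ (ν L : ℝ), 0 < ν → 0 < L → ∀ (u v p : ℝ → ℝ → ℝ → ℝ),
    IsStretchedLayerNSSolutionOn (Ioi 0) ν 1 1 L u v p →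
    (∀ a b : ℝ, 0 < a → a < b → ExpTails (Icc a b) u v) →
      (∃ B : ℝ, ∀ t : ℝ, 1 ≤ t → negEnstrophy L (u t) (v t) ≤ B) ∧
      (∀ t : ℝ, 0 < t → 0 < negMass L (u t) (v t) → 0 < negEnstrophy L (u t) (v t)) := by
  intro ν L hν hL u v p hsol htails
  refine ⟨?_, ?_⟩
  · -- (i) the upper bound for `t ≥ 1`
    obtain ⟨_, B, _, hB⟩ := stub_vorticityUniformBounds ν L hν hL u v p hsol htails
    refine ⟨B, fun t ht => ?_⟩
    obtain ⟨-, i₁, i₂⟩ := negPart_stripFacts hsol htails (one_pos.trans_le ht)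
    have e₁ : negEnstrophy L (u t) (v t) =
        ∫ q in Ioc 0 L ×ˢ univ, (max (-(vorticity (u t) (v t) q.1 q.2)) 0) ^ 2 :=
      integral_iterated_eq_strip i₁
    have e₂ : (∫ x in Ioc 0 L, ∫ y, vorticity (u t) (v t) x y ^ 2) =
        ∫ q in Ioc 0 L ×ˢ univ, vorticity (u t) (v t) q.1 q.2 ^ 2 :=
      integral_iterated_eq_strip i₂
    calc negEnstrophy L (u t) (v t)
        = ∫ q in Ioc 0 L ×ˢ univ, (max (-(vorticity (u t) (v t) q.1 q.2)) 0) ^ 2 := e₁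
      _ ≤ ∫ q in Ioc 0 L ×ˢ univ, vorticity (u t) (v t) q.1 q.2 ^ 2 :=
          setIntegral_mono i₁ i₂ fun q => negPart_sq_le_sq _
      _ = ∫ x in Ioc 0 L, ∫ y, vorticity (u t) (v t) x y ^ 2 := e₂.symm
      _ ≤ B := (hB t ht).2.1
  · -- (ii) positivity from a positive negative mass
    intro t ht hM
    obtain ⟨i₀, i₁, -⟩ := negPart_stripFacts hsol htails ht
    refine (negEnstrophy_nonneg L (u t) (v t)).lt_of_ne' fun h0 => ?_
    have e₁ : (∫ q in Ioc 0 L ×ˢ univ, (max (-(vorticity (u t) (v t) q.1 q.2)) 0) ^ 2) = 0 := by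
      rw [← integral_iterated_eq_strip i₁]
      exact h0
    have hae : (fun q : ℝ × ℝ => (max (-(vorticity (u t) (v t) q.1 q.2)) 0) ^ 2) =ᵐ[volume.restrict
        (Ioc 0 L ×ˢ univ)] 0 :=
      (integral_eq_zero_iff_of_nonneg (fun q => sq_nonneg _) i₁).1 e₁
    have hae' : (fun q : ℝ × ℝ => max (-(vorticity (u t) (v t) q.1 q.2)) 0) =ᵐ[volume.restrict
        (Ioc 0 L ×ˢ univ)] fun _ => (0 : ℝ) := by
      filter_upwards [hae] with q hq
      simpa using hq
    have e₂ : negMass L (u t) (v t) = 0 := by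
      have e : negMass L (u t) (v t) = ∫ q in Ioc 0 L ×ˢ univ, max (-(vorticity (u t) (v t) q.1 q.2)) 0 :=
        integral_iterated_eq_strip i₀
      rw [e, integral_congr_ae hae', integral_zero]
    exact (lt_irrefl (0 : ℝ)) (e₂ ▸ hM)

end Summit.AnomalousDissipation.AnomalousDissipation.Theorems.StrainedLayerLaw.LogEnstrophyClock

end
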